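import Mathlib
import Summits.NavierStokesRegularity.NavierStokesRegularity.Theses.MergerLadder
import Literature.Analysis.FluidPDE.VorticityCalculus
import HarnessLib

/-!
# `MergerLadder.LineStretchingIdentity` — the pointwise kernel of the circulation ledger
  (route `MergerLadder`, item stmt-NavierStokesRegularity-1056, support; exact, elementary)

**Statement.** For `u ∈ C²`, `ω = curl u`, `ξ = ω/|ω|` and `x` with `ω(x) ≠ 0`:
`|ω|⟪ξ, Du ξ⟫ = D(u·ξ)(x)[ω] − |ω|⟪u, Dξ(x) ξ⟫`.

PROOF. Product rule for `y ↦ ⟪u y, ξ y⟫` at `x` (where `ξ` is differentiable since `ω(x) ≠ 0`) in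
the direction `ω(x) = |ω(x)| ξ(x)`, and linearity.

HONEST FRAMING: pointwise calculus; nothing here bears on the regularity problem itself.
-/

noncomputable section

set_option linter.dupNamespace false

namespace Summit.NavierStokesRegularity.NavierStokesRegularity.Theorems

open Literature.Analysis Literature.Analysis.FluidPDE

/-- **Item stmt-NavierStokesRegularity-1056** (`MergerLadder.LineStretchingIdentity`). [this file] -/
theorem mergerLadder_lineStretchingIdentity_proof :
    Summit.NavierStokesRegularity.NavierStokesRegularity.Theses.MergerLadder.LineStretchingIdentity := by
  unfold Summit.NavierStokesRegularity.NavierStokesRegularity.Theses.MergerLadder.LineStretchingIdentity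
  intro u hu x hx
  set ω := curl u with hω
  have hω1 : ContDiff ℝ 1 ω := contDiff_curl (n := 1) (by exact hu)
  have hωd : DifferentiableAt ℝ ω x := (hω1.differentiable one_ne_zero).differentiableAt
  have hud : DifferentiableAt ℝ u x := (hu.differentiable (by norm_num)).differentiableAt
  have hnx : ‖ω x‖ ≠ 0 := norm_ne_zero_iff.2 hx
  -- `ξ` is differentiable at `x`
  have hξdef : vorticityDirection ω = fun y => ‖ω y‖⁻¹ • ω y := rfl
  have hξd : DifferentiableAt ℝ (vorticityDirection ω) x := by
    rw [hξdef]
    exact ((hωd.norm ℝ hx).inv hnx).smul hωd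
  -- `ω x = |ω x| • ξ x`
  have hωξ : ω x = ‖ω x‖ • vorticityDirection ω x := by
    rw [hξdef]
    simp only
    rw [smul_smul, mul_inv_cancel₀ hnx, one_smul]
  -- product rule in the direction `ω x`
  rw [fderiv_inner_apply ℝ hud hξd (ω x)]
  have e1 : fderiv ℝ (vorticityDirection ω) x (ω x) =
      ‖ω x‖ • fderiv ℝ (vorticityDirection ω) x (vorticityDirection ω x) := by
    conv_lhs => rw [hωξ]
    rw [map_smul]
  have e2 : fderiv ℝ u x (ω x) = ‖ω x‖ • fderiv ℝ u x (vorticityDirection ω x) := by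
    conv_lhs => rw [hωξ]
    rw [map_smul]
  rw [e1, e2, inner_smul_right, inner_smul_left, real_inner_comm (vorticityDirection ω x)]
  simp only [RCLike.conj_to_real]
  ring

end Summit.NavierStokesRegularity.NavierStokesRegularity.Theorems

end
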